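import Summits.KontsevichZagierPeriods.KontsevichZagierPeriods.Theses.TorsionLogs
import Summits.KontsevichZagierPeriods.KontsevichZagierPeriods.Theorems.TorsionLogsNeronTorsionSector

/-!
# F3 WITNESS for the rung `NeronTorsionAcrossDiscriminant` (line `NeronTorsionAcnodal` on crux `TorsionSectorComplete`,
# stmt-KontsevichZagierPeriods-14212; forward generator G1, seed g1-KontsevichZagierPeriods-17981)

The rung is the predicate-indexed family `NeronTorsionSectorOn ok` — the route's closed crux
`Theses.TorsionLogs.NeronTorsionSector` with its ONE hypothesis `g₂ ^ 3 - 27 * g₃ ^ 2 ≠ 0` replaced by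
`ok (g₂ ^ 3 - 27 * g₃ ^ 2)` — quantified over all `ok : ℝ → Prop` (`NeronTorsionAcrossDiscriminant := ∀ ok, …`, i.e. the
hypothesis deleted).  The floor specialises the rung at the parameter `ok := (· ≠ 0)`: the seed theorem
`Cruxes.NeronTorsionSector.Translation.stub_assembly` (item stmt-KontsevichZagierPeriods-17981, `NeronTorsionPrimitiveChain`)
through the landed bookkeeping `NeronTorsionSector_of_primitiveChain` IS that member (`Iff.rfl`).  No `sorry`.
Self-contained: verbatim copies of the two `def`s of `Lines/NeronTorsionAcnodal.lean` in the namespace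
`…NeronTorsionAcnodal.Special` (the skeleton module proves the same fact about the registered decl as
`neronTorsionSectorOn_ne`). [cite: KontsevichZagier2001, §1.2]
-/

noncomputable section

-- `Summit.KontsevichZagierPeriods.KontsevichZagierPeriods.…` is the tree's mandated layout (single-conjunct summit).
set_option linter.dupNamespace false

namespace Summit.KontsevichZagierPeriods.KontsevichZagierPeriods.Cruxes.TorsionSectorComplete.NeronTorsionAcnodal.Special
open Summit.KontsevichZagierPeriods.KontsevichZagierPeriods.Cruxes.NeronTorsionSector.Translation
  (NeronTorsionSector_of_primitiveChain stub_assembly NeronTorsionSector_of)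

/-- Verbatim copy of `Lines/NeronTorsionAcnodal.lean :: NeronTorsionSectorOn` (the family; `ok (Δ)` replaces `Δ ≠ 0`). -/
def NeronTorsionSectorOn (ok : ℝ → Prop) : Prop :=
  ∀ (g₂ g₃ e₁ xP yP α : ℝ) (N a : ℕ) (M k m : ℤ) (f : ℝ → ℝ), (∀ x, f x = 4 * x ^ 3 - g₂ * x - g₃) → ok (g₂ ^ 3 - 27 * g₃ ^ 2) → f e₁ = 0 → 0 < e₁ → (∀ x, e₁ < x → 0 < f x) → e₁ < xP → yP ^ 2 = f xP → 3 ≤ N → 0 < a → 2 * a < N → 4 * (N : ℤ) ^ 2 * k = M * ((N : ℤ) - 2 * (a : ℤ)) ^ 2 → (∀ hns : (⟨0, 0, 0, -g₂ / 4, -g₃ / 4⟩ : WeierstrassCurve ℝ).toAffine.Nonsingular xP (yP / 2), addOrderOf (WeierstrassCurve.Affine.Point.some xP (yP / 2) hns) = N) → (N : ℝ) * (∫ x in Set.Ioi xP, (Real.sqrt (f x))⁻¹) = a * (2 * ∫ x in Set.Ioi e₁, (Real.sqrt (f x))⁻¹) → 1 < α → ∀ (rI rP : Literature.NumberTheory.Transcendental.KZ.IntegralRep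 2) (rL : Literature.NumberTheory.Transcendental.KZ.IntegralRep 1), rI.domain = {z | e₁ < z 1 ∧ z 1 < z 0 ∧ z 0 < xP} → Set.EqOn rI.integrand (fun z => z 1 / (Real.sqrt (f (z 1)) * Real.sqrt (f (z 0)))) rI.domain → rP.domain = {z | e₁ < z 0 ∧ e₁ < z 1} → Set.EqOn rP.integrand (fun z => (Real.sqrt (f (z 0)))⁻¹ * ((g₂ * z 1 + 2 * g₃) / (2 * (z 1) ^ 2 * Real.sqrt (f (z 1))))) rP.domain → rL.domain = {t | 1 < t 0 ∧ t 0 < α} → Set.EqOn rL.integrand (fun t => (t 0)⁻¹) rL.domain → (M : ℝ) * rI.value + k * rP.value = m * rL.value → M • Literature.NumberTheory.Transcendental.KZ.of rI + k • Literature.NumberTheory.Transcendental.KZ.of rP - m • Literature.NumberTheory.Transcendental.KZ.of rL ∈ Literature.NumberTheory.Transcendental.KZ.relations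

/-- Verbatim copy of `Lines/NeronTorsionAcnodal.lean :: NeronTorsionAcrossDiscriminant` (THE RUNG). -/
def NeronTorsionAcrossDiscriminant : Prop := ∀ ok : ℝ → Prop, NeronTorsionSectorOn ok

/-- Member `(· ≠ 0)` is the floor's tied crux on the nose. -/
theorem ne_iff : NeronTorsionSectorOn (· ≠ 0) ↔
    Summit.KontsevichZagierPeriods.KontsevichZagierPeriods.Theses.TorsionLogs.NeronTorsionSector :=
  Iff.rfl

/-- **F3 witness (named):** the floor (seed `stub_assembly`, through the landed bookkeeping) is the member `(· ≠ 0)`. -/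
theorem rung_ne : NeronTorsionSectorOn (· ≠ 0) :=
  ne_iff.mpr (NeronTorsionSector_of_primitiveChain stub_assembly)

/-- **F3 witness in the brief's literal shape** `example : Rung <floor parameters> := by simpa [Rung] using <seed>`. -/
example : NeronTorsionSectorOn (· ≠ 0) := by
  simpa [NeronTorsionSectorOn] using
    (NeronTorsionSector_of_primitiveChain stub_assembly :
      Summit.KontsevichZagierPeriods.KontsevichZagierPeriods.Theses.TorsionLogs.NeronTorsionSector)

/-- The rung restricted to the floor's parameter is exactly what the floor proves: `Rung ↔ member (· = 0)` with the
member `(· ≠ 0)` discharged by the seed (split on `Δ = 0`). -/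
theorem rung_iff_eq : NeronTorsionAcrossDiscriminant ↔ NeronTorsionSectorOn (· = 0) := by
  refine ⟨fun h => h _, fun h ok => ?_⟩
  intro g₂ g₃ e₁ xP yP α N a M k m f hf _hok he he0 hpos hx hy hN ha ha2 htie htor hρ hα rI rP rL hdI hiI
    hdP hiP hdL hiL hval
  by_cases hΔ : g₂ ^ 3 - 27 * g₃ ^ 2 = 0
  · exact h g₂ g₃ e₁ xP yP α N a M k m f hf hΔ he he0 hpos hx hy hN ha ha2 htie htor hρ hα rI rP rL hdI hiI hdP
      hiP hdL hiL hval
  · exact rung_ne g₂ g₃ e₁ xP yP α N a M k m f hf hΔ he he0 hpos hx hy hN ha ha2 htie htor hρ hα rI rP rL hdI hiI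
      hdP hiP hdL hiL hval

end Summit.KontsevichZagierPeriods.KontsevichZagierPeriods.Cruxes.TorsionSectorComplete.NeronTorsionAcnodal.Special

end
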